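import Summits.AnomalousDissipation.AnomalousDissipation.Theorems.SolenoidalFractalHomogenisationLagrangianStepWEvenCertSlotsB
import HarnessLib

/-!
# K1L_D IS-half · E1-CERT v2 port, part 5/5: symbol bounds for `ΦB aB`, the finite certificate, and **`W_evenSlackB : ∃ a > 0, WCrossing.EvenSlackWindowB a WCrossing.ρB`**

Summits-side PORT (prover seat `ad-sawtooth-k1loc-p1` g12; tenure E1-LAND 2026-08-29T00:31:55Z) of planner ad-ideate-p5 g12's certificate spine
`Cruxes/LagrangianRenormalisationStep/Lines/onelevel_W_evenSlack_cert.lean` v2 (commit 88965dfa39cf; the mathematics, the numerics `evencert.py` / kit j321011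
and the custody `HOME/ad-ideate-p5/k1l-even-cert/` are p5's) for the IS-half obligation `stub_W_evenSlackB : ∃ a > 0, WCrossing.EvenSlackWindowB a WCrossing.ρB`
of K1L_D `stub_cellLawV0_IS` (stmt-AnomalousDissipation-27980).  The port states everything over the LANDED `WCrossing` definitions
(`…LagrangianStepWCrossing`, prover ad-k1loc-p3 g7) instead of the spine's §W copies and wires the spine's three analytic stubs to landed theorems
(`stub_oddEven ↦ oddEven_qsResp` p681750, `stub_N110U/L ↦ encl_N110U/L` p682297, point enclosures `↦ encl_N1xx` p681405); texts otherwise VERBATIM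
(namespace `…LagrangianStep.WEvenCert`).  NOT a proof of `stub_cellLawV0_IS`, of the crux K1L_D, of Onsager's conjecture or of anomalous dissipation;
rung leaf F-D1.A0.

Part 5: §4 `symb_ΦB_le`/`le_symb_ΦB`, §5 the four rational sign conditions `certU_signs`/`certL_signs`, §6 `evenSlackOnInterval_cert`, `evenSlackWindowB_cert` and the registered stub's statement `W_evenSlackB` BY NAME over `WCrossing`.
-/

set_option linter.dupNamespace false

noncomputable section

namespace Summit.AnomalousDissipation.AnomalousDissipation.Theorems.SolenoidalFractalHomogenisation.LagrangianStep.WEvenCert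

open Summit.AnomalousDissipation.AnomalousDissipation.Theorems
open Summit.AnomalousDissipation.AnomalousDissipation.Theorems.SolenoidalFractalHomogenisation.LagrangianStep
open Summit.AnomalousDissipation.AnomalousDissipation.Theorems.SolenoidalFractalHomogenisation.LagrangianStep.WCrossing
open Literature.Analysis Literature.Analysis.FluidPDE Literature.Analysis.FunctionSpaces
open Literature.Algebra.EuclideanLattices (norm_sq_fin_three)
open Set Real

/-! ## §4 Symbol bounds for `ΦB aB` on the interval -/

/-- `symb_ΦB` (E1-CERT v2 spine §4–§6, p5 g12). -/
theorem symb_ΦB (a : ℝ) (S : T4) (k p : Fin 3 → ℝ) :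
    Torus.symb (ΦB a S) k p = a * ∑ j, slotCoef cubatureWord j * (∑ a', (cubatureWord.phase j).e a' * k a') ^ 2 *
      ∑ i, ∑ i', p i * slotQ cubatureWord MB S j i i' * p i' := by
  show Torus.symb (a • excQS cubatureWord MB S) k p = _
  rw [Torus.symb_smul, symb_excQS]

/-- `lam_pos_of_mem` (E1-CERT v2 spine §4–§6, p5 g12). -/
theorem lam_pos_of_mem {lam : ℝ} (hlam : lam ∈ Icc lam0 LamW) : 0 < lam :=
  lt_of_lt_of_le lam0_pos hlam.1

/-- UPPER: `symb (ΦB aB S) ≤ (λ/λ₀)·aHat·(u₁I₁ + u₂I₂ + u₃I₃)`. -/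
theorem symb_ΦB_le {lam τ : ℝ} (hlam : lam ∈ Icc lam0 LamW) (hτ : τ ∈ Icc 0 τ0c) {S : T4}
    (hI : InInterval Sc lam S) (hO : OddSectorial S τ) (k p : Fin 3 → ℝ) :
    Torus.symb (ΦB aB S) k p ≤ lam / lam0 * aHat * (u1 * I1 k p + u2 * I2 k p + u3 * I3 k p) := by
  rw [symb_ΦB]
  have hsum : ∑ j, slotCoef cubatureWord j * (∑ a', (cubatureWord.phase j).e a' * k a') ^ 2 *
        ∑ i, ∑ i', p i * slotQ cubatureWord MB S j i i' * p i'
      ≤ ∑ j, slotCoef cubatureWord j * (∑ a', (cubatureWord.phase j).e a' * k a') ^ 2 * (lam / lam0 * uForm (slots j) p) := by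
    apply Finset.sum_le_sum
    intro j _
    exact mul_le_mul_of_nonneg_left (slot_upper hlam hτ hI hO j p) (mul_nonneg (slotCoef_nonneg _ _) (sq_nonneg _))
  have hid : ∑ j, slotCoef cubatureWord j * (∑ a', (cubatureWord.phase j).e a' * k a') ^ 2 * (lam / lam0 * uForm (slots j) p)
      = lam / lam0 / (2 * (2 * π) ^ 4 * 3720) * ∑ j, kCoef (slots j) k * uForm (slots j) p := by
    rw [Finset.mul_sum]
    refine Finset.sum_congr rfl fun j _ => ?_
    rw [slotCoef_mul_sq]
    ring
  rw [hid, sum_kCoef_uForm] at hsum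
  have hπ : (0:ℝ) < 2 * (2 * π) ^ 4 * 3720 := by positivity
  calc aB * _ ≤ aB * (lam / lam0 / (2 * (2 * π) ^ 4 * 3720) * (u1 * I1 k p + u2 * I2 k p + u3 * I3 k p)) :=
        mul_le_mul_of_nonneg_left hsum aB_pos.le
    _ = lam / lam0 * aHat * (u1 * I1 k p + u2 * I2 k p + u3 * I3 k p) := by
        unfold aB; field_simp

/-- LOWER: `(1/λ)·aHat·(l₁I₁ + l₂I₂ + l₃I₃) ≤ symb (ΦB aB S)`. -/
theorem le_symb_ΦB {lam τ : ℝ} (hlam : lam ∈ Icc lam0 LamW) (hτ : τ ∈ Icc 0 τ0c) {S : T4}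
    (hI : InInterval Sc lam S) (hO : OddSectorial S τ) (k p : Fin 3 → ℝ) :
    1 / lam * aHat * (l1 * I1 k p + l2 * I2 k p + l3 * I3 k p) ≤ Torus.symb (ΦB aB S) k p := by
  rw [symb_ΦB]
  have hsum : ∑ j, slotCoef cubatureWord j * (∑ a', (cubatureWord.phase j).e a' * k a') ^ 2 * (lForm (slots j) p / lam)
      ≤ ∑ j, slotCoef cubatureWord j * (∑ a', (cubatureWord.phase j).e a' * k a') ^ 2 *
        ∑ i, ∑ i', p i * slotQ cubatureWord MB S j i i' * p i' := by
    apply Finset.sum_le_sum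
    intro j _
    exact mul_le_mul_of_nonneg_left (slot_lower hlam hτ hI hO j p) (mul_nonneg (slotCoef_nonneg _ _) (sq_nonneg _))
  have hid : ∑ j, slotCoef cubatureWord j * (∑ a', (cubatureWord.phase j).e a' * k a') ^ 2 * (lForm (slots j) p / lam)
      = 1 / lam / (2 * (2 * π) ^ 4 * 3720) * ∑ j, kCoef (slots j) k * lForm (slots j) p := by
    rw [Finset.mul_sum]
    refine Finset.sum_congr rfl fun j _ => ?_
    rw [slotCoef_mul_sq]
    ring
  rw [hid, sum_kCoef_lForm] at hsum
  have hπ : (0:ℝ) < 2 * (2 * π) ^ 4 * 3720 := by positivity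
  calc 1 / lam * aHat * (l1 * I1 k p + l2 * I2 k p + l3 * I3 k p)
      = aB * (1 / lam / (2 * (2 * π) ^ 4 * 3720) * (l1 * I1 k p + l2 * I2 k p + l3 * I3 k p)) := by
        unfold aB; field_simp
    _ ≤ aB * _ := mul_le_mul_of_nonneg_left hsum aB_pos.le

/-! ## §5 The finite certificate: four sign conditions on rationals -/

/-- `certU_signs` (E1-CERT v2 spine §4–§6, p5 g12). -/
theorem certU_signs : aHat * u2 * (1 + δc) ≤ lam0 ∧ aHat * (u1 - u3) * (1 + δc) ≤ lam0 * (1 + κc) := by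
  unfold δc aHat u1 u2 u3 qA1 qA2 qA3 qB2 U100 U111 UA UB U100p U111p UAp ellBar βd lam0 κc; constructor <;> norm_num

/-- `certL_signs` (E1-CERT v2 spine §4–§6, p5 g12). -/
theorem certL_signs : 1 + δc ≤ aHat * l2 ∧ (1 + δc) * (1 + κc) ≤ aHat * (l1 - l3) := by
  unfold δc aHat l1 l2 l3 lA1 lA2 lA3 lB2 L100 L111 LA LB L100p L111p LAp ellBar LamW βd κc; constructor <;> norm_num

/-- UPPER face on transverse pairs: `(aHat/λ₀)(u₁I₁+u₂I₂+u₃I₃) ≤ symb Sc/(1+δ)`. -/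
theorem certU {k p : Fin 3 → ℝ} (h : ∑ i, p i * k i = 0) :
    aHat / lam0 * (u1 * I1 k p + u2 * I2 k p + u3 * I3 k p) ≤ Torus.symb Sc k p / (1 + δc) := by
  have hδ : (0:ℝ) < 1 + δc := by unfold δc; norm_num
  rw [symb_Sc, Nkp_eq, I3_eq_of_perp h, div_mul_eq_mul_div, div_le_div_iff₀ lam0_pos hδ]
  obtain ⟨hA, hB⟩ := certU_signs
  have h1 := I1_nonneg k p; have h2 := I2_nonneg k p
  nlinarith [mul_le_mul_of_nonneg_right hA h2, mul_le_mul_of_nonneg_right hB h1]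

/-- LOWER face on transverse pairs: `(1+δ) symb Sc ≤ aHat (l₁I₁+l₂I₂+l₃I₃)`. -/
theorem certL {k p : Fin 3 → ℝ} (h : ∑ i, p i * k i = 0) :
    (1 + δc) * Torus.symb Sc k p ≤ aHat * (l1 * I1 k p + l2 * I2 k p + l3 * I3 k p) := by
  rw [symb_Sc, Nkp_eq, I3_eq_of_perp h]
  obtain ⟨hA, hB⟩ := certL_signs
  have h1 := I1_nonneg k p; have h2 := I2_nonneg k p
  nlinarith [mul_le_mul_of_nonneg_right hA h2, mul_le_mul_of_nonneg_right hB h1]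

/-! ## §6 Assembly: the even clause with slack, and `EvenSlackWindowB aB ρB` -/

/-- THE EVEN CLAUSE WITH SLACK about `Sc` on `[λ₀, Λ_w] × [0, τ₀]`. -/
theorem evenSlackOnInterval_cert : EvenSlackOnInterval (ΦB aB) Sc lam0 LamW τ0c δc := by
  intro lam hlam S τ hτ hI hO
  have hlam0 : 0 < lam := lam_pos_of_mem hlam
  have hδ : (0:ℝ) < 1 + δc := by unfold δc; norm_num
  constructor
  · intro k p hkp
    rw [Torus.symb_smul]
    have hc := certL hkp
    have hlo := le_symb_ΦB hlam hτ hI hO k p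
    have e : 1 / (lam / (1 + δc)) * Torus.symb Sc k p = (1 / lam) * ((1 + δc) * Torus.symb Sc k p) := by
      field_simp
    rw [e]
    calc 1 / lam * ((1 + δc) * Torus.symb Sc k p) ≤ 1 / lam * (aHat * (l1 * I1 k p + l2 * I2 k p + l3 * I3 k p)) :=
          mul_le_mul_of_nonneg_left hc (by positivity)
      _ = 1 / lam * aHat * (l1 * I1 k p + l2 * I2 k p + l3 * I3 k p) := by ring
      _ ≤ _ := hlo
  · intro k p hkp
    rw [Torus.symb_smul]
    have hc := certU hkp
    have hup := symb_ΦB_le hlam hτ hI hO k p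
    calc Torus.symb (ΦB aB S) k p ≤ lam / lam0 * aHat * (u1 * I1 k p + u2 * I2 k p + u3 * I3 k p) := hup
      _ = lam * (aHat / lam0 * (u1 * I1 k p + u2 * I2 k p + u3 * I3 k p)) := by ring
      _ ≤ lam * (Torus.symb Sc k p / (1 + δc)) := mul_le_mul_of_nonneg_left hc hlam0.le
      _ = lam / (1 + δc) * Torus.symb Sc k p := by ring

/-- `EvenSlackWindowB aB ρB` with the explicit window numbers (all side conditions by `norm_num`). -/
theorem evenSlackWindowB_cert : EvenSlackWindowB aB ρB := by
  refine ⟨Sc, sloC, 1, lam0, LamW, lam0, LamV, τ0c, δc, nearIso_Sc, ?_, ?_, le_rfl, ?_, inInterval_Sc_iso, ?_, ?_, ?_, le_rfl, ?_, ?_, ?_, ?_,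
    ?_, ?_, ?_, ?_, evenSlackOnInterval_cert⟩
  all_goals norm_num [sloC, lam0, LamW, LamV, τ0c, δc, ρB]

/-- **THE STATEMENT OF `WCrossing.stub_W_evenSlackB`, from the two per-slot stubs.** -/
theorem W_evenSlackB : ∃ a > (0:ℝ), EvenSlackWindowB a ρB := ⟨aB, aB_pos, evenSlackWindowB_cert⟩

/-- **REGISTRY v14 STUB `stub_W_evenSlackB` OF K1L_D `stub_cellLawV0_IS` (stmt-AnomalousDissipation-27980), BY NAME AND SIGNATURE**: the even (W)-half of the
IS cell law at branch B — `∃ a > 0, WCrossing.EvenSlackWindowB a WCrossing.ρB` — is a kernel-checked certificate (planner ad-ideate-p5 g12's E1-CERT; analytic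
leaves S2/N by prover ad-sawtooth-k1loc-p1 g12; `WCrossing` port by prover ad-k1loc-p3 g7). -/
theorem stub_W_evenSlackB : ∃ a > (0:ℝ), WCrossing.EvenSlackWindowB a WCrossing.ρB := W_evenSlackB

end Summit.AnomalousDissipation.AnomalousDissipation.Theorems.SolenoidalFractalHomogenisation.LagrangianStep.WEvenCert
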